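import Literature.Computability.AlgebraicComplexity.AlperBogartVelasco
import Literature.Computability.AlgebraicComplexity.AlperBogartVelascoSubspace
import Literature.Computability.AlgebraicComplexity.AlperBogartVelascoBoxFour
import Literature.Computability.AlgebraicComplexity.DeterminantalComplexityProofs
import Literature.Computability.AlgebraicComplexity.PermanentVsDeterminantProofs
import HarnessLib

/-!
# Alper–Bogart–Velasco 2017, Cor. 1.4 — proof of the named fact `alperBogartVelasco2017_cor_1_4`

Topic `Literature/Computability/AlgebraicComplexity`; sibling proofs file of
`AlperBogartVelasco.lean`, which vendors J. Alper, T. Bogart, M. Velasco, *A lower bound for the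
determinantal complexity of a hypersurface*, Found. Comput. Math. 17 (2017) 829–836,
**Corollary 1.4**: over a field of characteristic `≠ 2`, `dc(perm_3) = 7` and `dc(perm_4) ≥ 9`.
This file DISCHARGES it (`alperBogartVelasco2017_cor_1_4_holds`), assembling:

* `AlperBogartVelascoSubspace.lean` — ABV Prop. 2.1 (von zur Gathen's regularity, from the
  tree's proof of vzG Thm. 3.1) and the proof of ABV Thm. 1.2 for `perm_m` up to the dimension
  count: a size-`n` affine determinantal representation of `perm_m` (`m ≥ 3`, `2 ≠ 0`) gives a
  linear space `W` of `m × m` matrices with `dim W ≥ m² - n + 1` on which all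
  `∂ perm_m / ∂x_{rc}` — the `(m-1) × (m-1)` subpermanents — vanish;
* `AlperBogartVelascoBoxThree.lean`, `AlperBogartVelascoBoxFour.lean` — such `W` have
  `dim W ≤ 3` (`m = 3`) and `dim W ≤ 8` (`m = 4`), the elementary replacements, for linear spaces,
  of ABV's "readily computed" `codim Sing(perm_3) = 6`, `codim Sing(perm_4) = 8`;
* hence `n ≥ 7`, resp. `n ≥ 9` (`seven_le_determinantalComplexity_perPoly_three`,
  `nine_le_determinantalComplexity_perPoly_four`; the infimum `dc` is attained,
  `hasDetRepr_determinantalComplexity_holds`), and `dc(perm_3) ≤ 2³ - 1 = 7` is Grenet's bound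
  (`determinantalComplexity_perPoly_le_holds`).

The hypothesis `char(k) ≠ 2` of the fact is `ringChar k ≠ 2`; for a field it gives `(2 : k) ≠ 0`
(`two_ne_zero_of_ringChar_ne_two`), the form in which von zur Gathen's theorem enters.

## References

* J. Alper, T. Bogart, M. Velasco, Found. Comput. Math. 17 (2017) 829–836,
  doi:10.1007/s10208-015-9300-x, arXiv:1505.02205 — Cor. 1.4, Thm. 1.2, Prop. 2.1.
* B. Grenet, *An upper bound for the permanent versus determinant problem* (2011), Thm. 1.
* J. von zur Gathen, *Permanent and determinant*, Linear Algebra Appl. 96 (1987) 87–100, Thm. 3.1.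
-/

noncomputable section

open Matrix MvPolynomial Module

namespace Literature.Computability.AlgebraicComplexity

namespace AlperBogartVelasco

/-- `(∂ perm/∂x_{rc})(x) = per x(r|c)`: evaluating the partial derivative of the generic
permanent at a point gives the permanent of the submatrix deleting row `r` and column `c`
(vzG87 §2; `VonZurGathen.pderiv_perPoly` with the rows and columns `≠ r, c` enumerated by
`Fin.succAbove`). [cite: Vonzurgathen1987, §2] -/
theorem eval_pderiv_perPoly_eq_permanent_submatrix {K : Type*} [Field K] {m : ℕ}
    (x : Fin (m + 1) × Fin (m + 1) → K) (r c : Fin (m + 1)) :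
    MvPolynomial.eval x (pderiv (r, c) (perPoly (Fin (m + 1)) K)) =
      ((Matrix.of fun i j => x (i, j)).submatrix r.succAbove c.succAbove).permanent := by
  rw [VonZurGathen.pderiv_perPoly, ← MvPolynomial.aeval_eq_eval, VonZurGathen.aeval_subperm_X,
    Matrix.subperm_eq_permanent_of_equiv _ (finSuccAboveEquiv c) (finSuccAboveEquiv r)]
  rfl

/-- **`dc(perm_3) ≥ 7`** over any field with `2 ≠ 0` (ABV Cor. 1.4, lower bound): a
representation of size `n = dc` gives `W` with `dim W ≥ 10 - n` and `dim W ≤ 3`.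
[cite: AlperBogartVelasco2017, Cor. 1.4] -/
theorem seven_le_determinantalComplexity_perPoly_three (K : Type*) [Field K] (h2 : (2 : K) ≠ 0) :
    7 ≤ determinantalComplexity (perPoly (Fin 3) K) := by
  obtain ⟨A, hA⟩ := hasDetRepr_determinantalComplexity_holds (perPoly (Fin 3) K)
  obtain ⟨W, hW, hvan⟩ := exists_subspace_of_isAffineDetRepr_perPoly h2 le_rfl hA
  have hfin : finrank K W ≤ 3 :=
    finrank_le_three_of_subperm_two_vanish W fun x hx r c => by
      rw [← eval_pderiv_perPoly_eq_permanent_submatrix]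
      exact hvan x hx (r, c)
  omega

/-- **`dc(perm_4) ≥ 9`** over any field with `2 ≠ 0` (ABV Cor. 1.4, second part): a
representation of size `n = dc` gives `W` with `dim W ≥ 17 - n` and `dim W ≤ 8`.
[cite: AlperBogartVelasco2017, Cor. 1.4] -/
theorem nine_le_determinantalComplexity_perPoly_four (K : Type*) [Field K] (h2 : (2 : K) ≠ 0) :
    9 ≤ determinantalComplexity (perPoly (Fin 4) K) := by
  obtain ⟨A, hA⟩ := hasDetRepr_determinantalComplexity_holds (perPoly (Fin 4) K)
  obtain ⟨W, hW, hvan⟩ := exists_subspace_of_isAffineDetRepr_perPoly h2 (by norm_num) hA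
  have hfin : finrank K W ≤ 8 :=
    finrank_le_eight_of_subperm_three_vanish W fun x hx r c => by
      rw [← eval_pderiv_perPoly_eq_permanent_submatrix]
      exact hvan x hx (r, c)
  omega

/-- For a field, `char(k) ≠ 2` in the form `ringChar k ≠ 2` gives `(2 : k) ≠ 0` (the
characteristic of a field divides `2` only if it is `2`). This is Mathlib's `Ring.two_ne_zero`
(any nontrivial semiring); the name is kept for `perm_read_once_universal` below. [folklore] -/
theorem two_ne_zero_of_ringChar_ne_two {k : Type*} [Field k] (h : ringChar k ≠ 2) :
    (2 : k) ≠ 0 :=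
  Ring.two_ne_zero h

end AlperBogartVelasco

/-- **Alper–Bogart–Velasco 2017, Corollary 1.4 — PROVED**: over a field `k` with
`char(k) ≠ 2`, `dc(perm_3) = 7` and `dc(perm_4) ≥ 9`.  The lower bounds are ABV's Thm. 1.2 for the
permanent (`AlperBogartVelascoSubspace.lean`: von zur Gathen's regularity, normal form
`J + Z(x)`, `Z₁₁ = 0`, `Σ_j Z_{1j}Z_{j1} = 0`, `V(I) ⊆ Sing`, isotropy) combined with the elementary
bounds `dim ≤ 3`, `dim ≤ 8` for linear spaces of matrices with vanishing submaximal subpermanents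
(`AlperBogartVelascoBoxThree/Four.lean`, replacing "`codim Sing(perm_3) = 6`,
`codim Sing(perm_4) = 8` … readily computed"); the upper bound `dc(perm_3) ≤ 7` is Grenet's
(`determinantalComplexity_perPoly_le_holds`). [cite: AlperBogartVelasco2017, Corollary 1.4] -/
theorem alperBogartVelasco2017_cor_1_4_holds : alperBogartVelasco2017_cor_1_4 := by
  intro k _ hchar
  have h2 := AlperBogartVelasco.two_ne_zero_of_ringChar_ne_two hchar
  refine ⟨le_antisymm ?_ (AlperBogartVelasco.seven_le_determinantalComplexity_perPoly_three k h2),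
    AlperBogartVelasco.nine_le_determinantalComplexity_perPoly_four k h2⟩
  have h7 := determinantalComplexity_perPoly_le_holds k 3 (by norm_num)
  norm_num at h7
  exact h7

end Literature.Computability.AlgebraicComplexity
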